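import Summits.QuantumFields.YangMills.Theorems.TwistedTraceScaling.Negative.ValleyFloorLedger
import Summits.QuantumFields.YangMills.Theorems.LuscherReductionTwistedTraceScalingVacuumFloor
import HarnessLib

/-!
# R13b (crux `TwistedTraceScaling`, stmt-QuantumFields-20203): lane A's hand-over interface `coarseNoIntruderAt_of_vacuumFloor_pow` (p590973) —
# NO vacuum floor `(Λ, tol)` whatsoever admits the normalisation comparison `N_B·e^{−6Z₀} ≤ Λ·e^{o(β^{−p})}` when `3r < 1 + 3m` (every `L ≥ 1`, every `q`),
# nor at `L = 1` when `m ≤ 2p` or `3r ≤ 1 + 3m + p`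

Standing disprover `ym-cdisprove-20203-1` (gen 12), sequel to `…Negative.ValleyFloorLedger` (R13, p591007).  Lane A's FINAL interface of gen 9
(`…TwistedTraceScalingVacuumFloor`, p590973) replaces the typed input FLOOR(N_B) of `coarseNoIntruderAt_of_floor_pow` by THREE inputs for lane B:
a vacuum floor `hV : VacuumFloorAt L Λ tol` (eventually `Λ·e^{−tol} ≤ λ₀`), `htol : tol = o(β^{−p})`, and the NORMALISATION COMPARISON
`hcmp : ∀ ε > 0, eventually N_B(β)·e^{−6·toronZPE L (1/2) 0 0} ≤ Λ(β)·e^{ε·β^{−p}}` (`N_B β = riccatiN L β β^{−r} (2β^{−q}) β^{−m}`), composed through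
`valleyFloorAt_of_vacuumFloor : hV → hΛ → htol → hcmp → ValleyFloorAt L δ κ N`.  Since R13 refutes the conclusion off the exponent ledger, the inputs are
JOINTLY unsatisfiable there — for EVERY candidate `(Λ, tol)`, in particular for the true vacuum `Λ = λ₀`, `tol = 0`:
* ★ `no_vacuumFloor_comparison (L) (hp : 0 ≤ p) (hr : 0 ≤ r) (h : 3r < 1 + 3m) : ¬ ∃ Λ tol, (∀ β, 0 ≤ Λ β) ∧ VacuumFloorAt L Λ tol ∧ htol ∧ hcmp`;
* ★ `no_vacuumFloor_comparison_one (hr : 0 ≤ r) (hm : 0 ≤ m) (h : m ≤ 2p ∨ 3r ≤ 1 + 3m + p)` — the same at `L = 1`;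
* `vacuumFloor_comparison_false` / `…_one_false` — the contrapositive lane B will meet: GIVEN any correct floor `(Λ, tol)` with `tol = o(β^{−p})`, the comparison
  `hcmp` with lane B's `riccatiN` FAILS off the ledger (so `coarseNoIntruderAt_of_vacuumFloor_pow` is vacuous on `3r ≤ 1 + 3m` of its typed range, exactly like
  `coarseNoIntruderAt_of_floor_pow`);
* `vacuumFloorAt_levelValue` — the trivial admissible pair `(λ₀, 0)`, showing the obstruction is in `hcmp`, not in the existence of a floor.
READING (COARSE-DESIGN §17.10): the comparison asks `log(N_B/N_free) ≤ 6Z₀(L) + log(Λ/λ₀) + tol + εβ^{−p}`, and `Λ ≤ λ₀e^{tol} ≤ N_free e^{tol}`; so whatever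
lane B's adiabatic `Λ_B` is, the loaded exponents of `riccatiN` must be bounded at every `L` and `o(β^{−p})` at `L = 1` — the ledger `3r > 1 + 3m (+p)`, `m > 2p`
is a precondition of the hand-over itself; the point of record `(1/40, 0.85, 0.41, 0.055)` passes.  NO KILL of the crux, of `VacuumFloorAt` for lane B's (untyped)
`Λ_B`, or of the comparison on the ledger.
HONEST FRAMING: bookkeeping about typed inputs of a stub lane (S-BASE C3) of a child of the CONDITIONAL reduction route (femto rung R2b1); not
`¬TwistedTraceScaling`, not infinite volume, not a gap, not Clay.  Sorry-free, no new definition; axioms ⊆ {propext, Classical.choice, Quot.sound}.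
-/

set_option autoImplicit false

noncomputable section

open Real
open Literature.MathematicalPhysics.QuantumFieldTheory
open Summit.QuantumFields.YangMills.Theorems.FemtoTransferGap
open Summit.QuantumFields.YangMills.Theorems.FemtoTransferGap.TwoLattice.Toron

namespace Summit.QuantumFields.YangMills.Theorems.TwistedTraceScaling.Negative.R13

/-- The true vacuum is an admissible floor: `VacuumFloorAt L λ₀ 0`. [folklore] -/
theorem vacuumFloorAt_levelValue (L : ℕ) [NeZero L] : VacuumFloorAt L (fun β => levelValue su2Rep L β 0) (fun _ => 0) :=
  ⟨0, fun β _ => by simp⟩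

/-- **Given ANY correct vacuum floor with `tol = o(β^{−p})`, lane B's comparison fails off the ledger** (every `L ≥ 1`, every `q`; `p, r ≥ 0`, `3r < 1 + 3m`):
`¬ ∀ ε > 0, eventually N_B·e^{−6Z₀} ≤ Λ·e^{εβ^{−p}}`. [cite: Luscher1983, §3] -/
theorem vacuumFloor_comparison_false (L : ℕ) [NeZero L] {p q r m : ℝ} (hp : 0 ≤ p) (hr : 0 ≤ r) (h : 3 * r < 1 + 3 * m)
    {Λ tol : ℝ → ℝ} (hΛ : ∀ β, 0 ≤ Λ β) (hV : VacuumFloorAt L Λ tol)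
    (htol : ∀ ε : ℝ, 0 < ε → ∃ β0 : ℝ, ∀ β : ℝ, β0 ≤ β → tol β ≤ ε * powScale p β) :
    ¬ ∀ ε : ℝ, 0 < ε → ∃ β0 : ℝ, ∀ β : ℝ, β0 ≤ β →
      riccatiN L β (powScale r β) (2 * powScale q β) (powScale m β) * Real.exp (-(6 * toronZPE L (1 / 2) 0 0)) ≤
        Λ β * Real.exp (ε * powScale p β) :=
  fun hcmp => valleyFloorAt_riccatiN_false L (q := q) hp hr h (valleyFloorAt_of_vacuumFloor hV hΛ htol hcmp)

/-- ★ **NO VACUUM FLOOR ADMITS THE COMPARISON OFF THE LEDGER**: for `p, r ≥ 0`, `3r < 1 + 3m` (every `L ≥ 1`, every `q`) there is no pair `(Λ, tol)` with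
`Λ ≥ 0`, `VacuumFloorAt L Λ tol`, `tol = o(β^{−p})` and `N_B·e^{−6Z₀} ≤ Λ·e^{o(β^{−p})}` — the inputs `hV`, `htol`, `hcmp` of `coarseNoIntruderAt_of_vacuumFloor_pow`
are jointly unsatisfiable there. [cite: Luscher1983, §3] -/
theorem no_vacuumFloor_comparison (L : ℕ) [NeZero L] {p q r m : ℝ} (hp : 0 ≤ p) (hr : 0 ≤ r) (h : 3 * r < 1 + 3 * m) :
    ¬ ∃ Λ tol : ℝ → ℝ, (∀ β, 0 ≤ Λ β) ∧ VacuumFloorAt L Λ tol ∧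
      (∀ ε : ℝ, 0 < ε → ∃ β0 : ℝ, ∀ β : ℝ, β0 ≤ β → tol β ≤ ε * powScale p β) ∧
      (∀ ε : ℝ, 0 < ε → ∃ β0 : ℝ, ∀ β : ℝ, β0 ≤ β →
        riccatiN L β (powScale r β) (2 * powScale q β) (powScale m β) * Real.exp (-(6 * toronZPE L (1 / 2) 0 0)) ≤
          Λ β * Real.exp (ε * powScale p β)) :=
  fun ⟨_, _, hΛ, hV, htol, hcmp⟩ => vacuumFloor_comparison_false L hp hr h hΛ hV htol hcmp

/-- **At `L = 1`**: given any correct floor with `tol = o(β^{−p})`, the comparison fails when `m ≤ 2p` or `3r ≤ 1 + 3m + p` (`r, m ≥ 0`). [cite: Luscher1983, §3] -/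
theorem vacuumFloor_comparison_one_false {p q r m : ℝ} (hr : 0 ≤ r) (hm : 0 ≤ m) (h : m ≤ 2 * p ∨ 3 * r ≤ 1 + 3 * m + p)
    {Λ tol : ℝ → ℝ} (hΛ : ∀ β, 0 ≤ Λ β) (hV : VacuumFloorAt 1 Λ tol)
    (htol : ∀ ε : ℝ, 0 < ε → ∃ β0 : ℝ, ∀ β : ℝ, β0 ≤ β → tol β ≤ ε * powScale p β) :
    ¬ ∀ ε : ℝ, 0 < ε → ∃ β0 : ℝ, ∀ β : ℝ, β0 ≤ β →
      riccatiN 1 β (powScale r β) (2 * powScale q β) (powScale m β) * Real.exp (-(6 * toronZPE 1 (1 / 2) 0 0)) ≤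
        Λ β * Real.exp (ε * powScale p β) :=
  fun hcmp => valleyFloorAt_riccatiN_one_false (q := q) hr hm h (valleyFloorAt_of_vacuumFloor hV hΛ htol hcmp)

/-- ★ **At `L = 1` no vacuum floor admits the comparison unless `m > 2p` and `3r > 1 + 3m + p`.** [cite: Luscher1983, §3] -/
theorem no_vacuumFloor_comparison_one {p q r m : ℝ} (hr : 0 ≤ r) (hm : 0 ≤ m) (h : m ≤ 2 * p ∨ 3 * r ≤ 1 + 3 * m + p) :
    ¬ ∃ Λ tol : ℝ → ℝ, (∀ β, 0 ≤ Λ β) ∧ VacuumFloorAt 1 Λ tol ∧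
      (∀ ε : ℝ, 0 < ε → ∃ β0 : ℝ, ∀ β : ℝ, β0 ≤ β → tol β ≤ ε * powScale p β) ∧
      (∀ ε : ℝ, 0 < ε → ∃ β0 : ℝ, ∀ β : ℝ, β0 ≤ β →
        riccatiN 1 β (powScale r β) (2 * powScale q β) (powScale m β) * Real.exp (-(6 * toronZPE 1 (1 / 2) 0 0)) ≤
          Λ β * Real.exp (ε * powScale p β)) :=
  fun ⟨_, _, hΛ, hV, htol, hcmp⟩ => vacuumFloor_comparison_one_false hr hm h hΛ hV htol hcmp

/-- **The comparison against the TRUE vacuum** (`Λ = λ₀`, `tol = 0`) fails off the ledger: eventually-`N_B e^{−6Z₀} ≤ λ₀ e^{εβ^{−p}}` for all `ε > 0` is false for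
`3r < 1 + 3m` — this is FLOOR(N_B) again, read through lane A's own composition. [cite: Luscher1983, §3] -/
theorem trueVacuum_comparison_false (L : ℕ) [NeZero L] {p q r m : ℝ} (hp : 0 ≤ p) (hr : 0 ≤ r) (h : 3 * r < 1 + 3 * m) :
    ¬ ∀ ε : ℝ, 0 < ε → ∃ β0 : ℝ, ∀ β : ℝ, β0 ≤ β →
      riccatiN L β (powScale r β) (2 * powScale q β) (powScale m β) * Real.exp (-(6 * toronZPE L (1 / 2) 0 0)) ≤
        levelValue su2Rep L β 0 * Real.exp (ε * powScale p β) :=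
  vacuumFloor_comparison_false L hp hr h (fun β => (topValue_su2Rep_pos L β).le.trans_eq (levelValue_zero (ρ := su2Rep) L β).symm)
    (vacuumFloorAt_levelValue L) fun ε hε => ⟨0, fun β _ => by
      have := mul_nonneg hε.le (powScale_pos p β).le; simpa using this⟩

/-- Vacuity witness for `coarseNoIntruderAt_of_vacuumFloor_pow`: at `(p,q,r,m) = (1/40, 0.85, 0.35, 0.055)` (inside its typed range) no `(Λ, tol)` can supply
`hV ∧ htol ∧ hcmp`. -/
example (L : ℕ) [NeZero L] :
    ¬ ∃ Λ tol : ℝ → ℝ, (∀ β, 0 ≤ Λ β) ∧ VacuumFloorAt L Λ tol ∧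
      (∀ ε : ℝ, 0 < ε → ∃ β0 : ℝ, ∀ β : ℝ, β0 ≤ β → tol β ≤ ε * powScale (1 / 40) β) ∧
      (∀ ε : ℝ, 0 < ε → ∃ β0 : ℝ, ∀ β : ℝ, β0 ≤ β →
        riccatiN L β (powScale 0.35 β) (2 * powScale 0.85 β) (powScale 0.055 β) * Real.exp (-(6 * toronZPE L (1 / 2) 0 0)) ≤
          Λ β * Real.exp (ε * powScale (1 / 40) β)) :=
  no_vacuumFloor_comparison L (by norm_num) (by norm_num) (by norm_num)

end Summit.QuantumFields.YangMills.Theorems.TwistedTraceScaling.Negative.R13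

end
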